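import Literature.GroupTheory.CombinatorialGroupTheory.SurfaceGroupHeisenbergLift
import Mathlib.LinearAlgebra.BilinearForm.Orthogonal
import Mathlib.LinearAlgebra.FiniteDimensional.Lemmas
import Mathlib.Algebra.Field.ZMod
import HarnessLib

/-!
# Isotropic pairs of characters of a surface group with prescribed values (Heisenberg obstruction)

Topic `Literature/GroupTheory/CombinatorialGroupTheory`; theorems only, over the tree's surface group
`S_h = ⟨a₁, b₁, …, a_h, b_h ∣ ∏ᵢ [aᵢ, bᵢ]⟩` (`Literature.Topology.FourManifolds.SurfaceGroup h`, generators
`surfaceGen h = Fin h × Bool`) and abc-iut-L5-t17's `SurfaceGroupHeisenbergLift.lean`.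

The **Heisenberg obstruction** of a pair of `𝔽_p`-characters `Φ = (Φ₁, Φ₂)` of `S_h` is
`ω(Φ) = ∑ᵢ (Φ₁(aᵢ) Φ₂(bᵢ) - Φ₂(aᵢ) Φ₁(bᵢ))` (the cup product `Φ₁ ∪ Φ₂`, i.e. the intersection form
`ν` of Zieschang–Vogt–Coldewey 3.6.5 on the value vectors `surfaceGen h → 𝔽_p`).  PROVED here:

* `symplZMod_separatingLeft` / `_separatingRight` — `ν` is nondegenerate over the field `𝔽_p`.
* `exists_pair_symplZMod_eq_zero` — **the isotropic-pair lemma**: for genus `h ≥ 3` and ANY two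
  `𝔽_p`-linear functionals `E₁, E₂` on `𝔽_p^{2h}` for which vectors with `(E₁, E₂)`-values `(1, 0)` and
  `(0, 1)` exist, there exist such vectors `u, v` with moreover `ν(u, v) = 0`.  (If not, the common
  kernel `K` of `E₁, E₂`, of dimension `≥ 2h - 2`, would be totally isotropic — a linear functional on `K`
  missing one value is zero — whereas isotropic subspaces of the nondegenerate alternating `ν` have
  dimension `≤ h`; `2h - 2 ≤ h` contradicts `h ≥ 3`.)  This replaces the degree formula
  `ω(Φ|_K) = ± [S : K] ω(Φ)` ("F_res") in arguments that need a pair of characters with prescribed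
  values at two commuting elements of a profinite completion AND vanishing obstruction.
* `SurfaceGroup.character_eq_toCommGroup`, `SurfaceGroup.obstruction_eq_symplZMod` — dictionary
  between characters `S_h → 𝔽_p` and value vectors; `ω` of the pair of characters with value vectors
  `u, v` IS `ν(u, v)`.
* `exists_extraspecial_lift_card` — abc-iut-L5-t17's `exists_extraspecial_lift` with the ORDER of the
  extraspecial group exposed (`Nat.card E = p ^ 3`, needed to extend lifts over pro-`Σ` completions,
  which only see finite quotients of `Σ`-order); same construction (the cocycle extension of `𝔽_p²` by
  `𝔽_p` with cocycle `u₁ v₂`).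

## References

* H. Zieschang, E. Vogt, H.-D. Coldewey, *Surfaces and Planar Discontinuous Groups*, LNM 835 (1980),
  3.6.5 (intersection form). [ZieschangVogtColdewey1980]
* K. S. Brown, *Cohomology of Groups*, GTM 87 (1982), IV §3 (cocycle extensions). [Brown1982CohomologyGroups]
-/

noncomputable section

namespace Literature.GroupTheory.CombinatorialGroupTheory

open Literature.Topology.FourManifolds Literature.Algebra.Homology Multiplicative groupCohomology
open Module

/-! ### The intersection form over `𝔽_p` is nondegenerate -/

section SymplZMod

variable {K : Type*} [Field K] {h : ℕ}

/-- Left nondegeneracy of `ν(u, v) = ∑ᵢ (u(aᵢ) v(bᵢ) - u(bᵢ) v(aᵢ))` over a field: if `ν(u, ·) = 0`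
then `u = 0` (test against the basis vectors `δ_{bⱼ}`, `δ_{aⱼ}`). [cite: ZieschangVogtColdewey1980, 3.6.5] -/
theorem symplZMod_left_eq_zero (u : surfaceGen h → K)
    (hu : ∀ v : surfaceGen h → K, ∑ i, (u (i, false) * v (i, true) - u (i, true) * v (i, false)) = 0) :
    u = 0 := by
  classical
  funext x
  obtain ⟨j, b⟩ := x
  cases b
  · -- `u (j, false)`: test against `δ_{(j, true)}`
    have h1 := hu (Pi.single (j, true) 1)
    rw [Finset.sum_eq_single j] at h1
    · simpa using h1
    · intro i _ hij
      simp [hij]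
    · intro hj; exact absurd (Finset.mem_univ j) hj
  · -- `u (j, true)`: test against `δ_{(j, false)}`
    have h1 := hu (Pi.single (j, false) 1)
    rw [Finset.sum_eq_single j] at h1
    · simpa using h1
    · intro i _ hij
      simp [hij]
    · intro hj; exact absurd (Finset.mem_univ j) hj

/-- Right nondegeneracy of `ν`: if `ν(·, v) = 0` then `v = 0`. [cite: ZieschangVogtColdewey1980, 3.6.5] -/
theorem symplZMod_right_eq_zero (v : surfaceGen h → K)
    (hv : ∀ u : surfaceGen h → K, ∑ i, (u (i, false) * v (i, true) - u (i, true) * v (i, false)) = 0) :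
    v = 0 := by
  apply symplZMod_left_eq_zero v
  intro u
  have h1 := hv u
  have : ∑ i, (v (i, false) * u (i, true) - v (i, true) * u (i, false)) =
      -∑ i, (u (i, false) * v (i, true) - u (i, true) * v (i, false)) := by
    rw [← Finset.sum_neg_distrib]
    exact Finset.sum_congr rfl fun i _ => by ring
  rw [this, h1, neg_zero]

/-- **The isotropic-pair lemma.**  Let `h ≥ 3`, `K` a field, `E₁, E₂` two linear functionals on
`K^{2h} = (surfaceGen h → K)`, and suppose vectors `u₀, v₀` with `(E₁, E₂)(u₀) = (1, 0)`,
`(E₁, E₂)(v₀) = (0, 1)` exist.  Then there are such vectors `u, v` with moreover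
`ν(u, v) = ∑ᵢ (u(aᵢ) v(bᵢ) - u(bᵢ) v(aᵢ)) = 0`.  (Otherwise the common kernel of `E₁, E₂` — of
dimension `≥ 2h - 2` — is totally isotropic for the nondegenerate alternating form `ν`, hence of
dimension `≤ h`; impossible for `h ≥ 3`.) [cite: ZieschangVogtColdewey1980, 3.6.5] -/
theorem exists_pair_symplZMod_eq_zero (hh : 3 ≤ h) (E₁ E₂ : (surfaceGen h → K) →ₗ[K] K)
    (u₀ v₀ : surfaceGen h → K) (hu₁ : E₁ u₀ = 1) (hu₂ : E₂ u₀ = 0) (hv₁ : E₁ v₀ = 0)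
    (hv₂ : E₂ v₀ = 1) :
    ∃ u v : surfaceGen h → K, E₁ u = 1 ∧ E₂ u = 0 ∧ E₁ v = 0 ∧ E₂ v = 1 ∧
      ∑ i, (u (i, false) * v (i, true) - u (i, true) * v (i, false)) = 0 := by
  classical
  -- the form `ν` as a bilinear form
  let B : LinearMap.BilinForm K (surfaceGen h → K) :=
    LinearMap.mk₂ K (fun u v => ∑ i, (u (i, false) * v (i, true) - u (i, true) * v (i, false)))
      (fun u u' v => by
        simp only [Pi.add_apply, ← Finset.sum_add_distrib]
        exact Finset.sum_congr rfl fun i _ => by ring)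
      (fun c u v => by
        simp only [Pi.smul_apply, smul_eq_mul, Finset.mul_sum]
        exact Finset.sum_congr rfl fun i _ => by ring)
      (fun u v v' => by
        simp only [Pi.add_apply, ← Finset.sum_add_distrib]
        exact Finset.sum_congr rfl fun i _ => by ring)
      (fun c u v => by
        simp only [Pi.smul_apply, smul_eq_mul, Finset.mul_sum]
        exact Finset.sum_congr rfl fun i _ => by ring)
  have hB : ∀ u v : surfaceGen h → K,
      B u v = ∑ i, (u (i, false) * v (i, true) - u (i, true) * v (i, false)) := fun u v => rfl
  by_contra hcon
  push Not at hcon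
  -- `hcon : ∀ u v, E₁ u = 1 → E₂ u = 0 → E₁ v = 0 → E₂ v = 1 → ν(u, v) ≠ 0`
  -- the common kernel
  let W : Submodule K (surfaceGen h → K) := LinearMap.ker E₁ ⊓ LinearMap.ker E₂
  have hWmem : ∀ {x}, x ∈ W ↔ E₁ x = 0 ∧ E₂ x = 0 := fun {x} => by
    simp only [W, Submodule.mem_inf, LinearMap.mem_ker]
  -- Step 1: `ν(u₀ + x, y) = 0` for all `x, y ∈ W`
  have step1 : ∀ x ∈ W, ∀ y ∈ W, B (u₀ + x) y = 0 := by
    intro x hx y hy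
    by_contra hne
    -- rescale `y` to make `ν(u₀ + x, v₀ + t • y) = 0`
    set d := B (u₀ + x) y with hd
    set c := B (u₀ + x) v₀ with hc
    let t : K := -c / d
    have hxW := (hWmem).mp hx
    have hyW := (hWmem).mp hy
    have h1 : E₁ (u₀ + x) = 1 := by rw [map_add, hu₁, hxW.1, add_zero]
    have h2 : E₂ (u₀ + x) = 0 := by rw [map_add, hu₂, hxW.2, add_zero]
    have h3 : E₁ (v₀ + t • y) = 0 := by rw [map_add, map_smul, hv₁, hyW.1, smul_zero, add_zero]
    have h4 : E₂ (v₀ + t • y) = 1 := by rw [map_add, map_smul, hv₂, hyW.2, smul_zero, add_zero]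
    have h5 := hcon (u₀ + x) (v₀ + t • y) h1 h2 h3 h4
    rw [← hB, map_add, map_smul, smul_eq_mul, ← hc, ← hd] at h5
    apply h5
    show c + -c / d * d = 0
    rw [div_mul_cancel₀ _ hne, add_neg_cancel]
  -- Step 2: `W` is totally isotropic
  have step2 : ∀ x ∈ W, ∀ y ∈ W, B x y = 0 := by
    intro x hx y hy
    have h1 := step1 x hx y hy
    have h0 := step1 0 W.zero_mem y hy
    rw [add_zero] at h0
    rw [map_add, LinearMap.add_apply, h0, zero_add] at h1
    exact h1
  -- Step 3: dimension count
  have hnd : B.Nondegenerate := by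
    refine ⟨fun u hu => symplZMod_left_eq_zero u fun v => ?_, fun v hv => symplZMod_right_eq_zero v fun u => ?_⟩
    · rw [← hB]; exact hu v
    · rw [← hB]; exact hv u
  have hWle : W ≤ B.orthogonal W := by
    intro y hy
    rw [LinearMap.BilinForm.mem_orthogonal_iff]
    intro x hx
    exact step2 x hx y hy
  have hdimV : finrank K (surfaceGen h → K) = 2 * h := by
    rw [finrank_fintype_fun_eq_card, Fintype.card_prod, Fintype.card_fin, Fintype.card_bool]
    ring
  have hWorth : finrank K (B.orthogonal W) = 2 * h - finrank K W := by
    rw [LinearMap.BilinForm.finrank_orthogonal hnd W, hdimV]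
  have hW1 : finrank K W ≤ 2 * h - finrank K W := hWorth ▸ Submodule.finrank_mono hWle
  -- `finrank W ≥ 2h - 2` from rank–nullity for `(E₁, E₂)`
  have hW2 : 2 * h ≤ finrank K W + 2 := by
    have hker : LinearMap.ker (E₁.prod E₂) = W := LinearMap.ker_prod E₁ E₂
    have hrn := LinearMap.finrank_range_add_finrank_ker (E₁.prod E₂)
    rw [hker, hdimV] at hrn
    have hr : finrank K (LinearMap.range (E₁.prod E₂)) ≤ 2 := by
      calc finrank K (LinearMap.range (E₁.prod E₂)) ≤ finrank K (K × K) := Submodule.finrank_le _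
        _ = 2 := by rw [finrank_prod, finrank_self]
    omega
  have hWfin : finrank K W ≤ 2 * h := by
    calc finrank K W ≤ finrank K (surfaceGen h → K) := Submodule.finrank_le W
      _ = 2 * h := hdimV
  omega

end SymplZMod

/-! ### Characters of `S_h` with values in `𝔽_p` and the Heisenberg obstruction of a pair -/

section Characters

variable {h : ℕ} {p : ℕ}

/-- Every character `χ : S_h → 𝔽_p^×` (multiplicative notation for `𝔽_p`) is the `toCommGroup`-extension
of its values on the generators. [cite: HatcherAT2002, §1.2 p. 51] -/
theorem SurfaceGroup.character_eq_toCommGroup (χ : SurfaceGroup h →* Multiplicative (ZMod p)) :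
    χ = SurfaceGroup.toCommGroup fun x => χ (PresentedGroup.of x) :=
  PresentedGroup.ext fun x => by rw [SurfaceGroup.toCommGroup_of]

/-- `toCommGroup` is multiplicative in the generator images (pointwise product of characters).
[cite: HatcherAT2002, §1.2 p. 51] -/
theorem SurfaceGroup.toCommGroup_mul {G : Type*} [CommGroup G] (f f' : surfaceGen h → G) :
    SurfaceGroup.toCommGroup (f * f') = SurfaceGroup.toCommGroup f * SurfaceGroup.toCommGroup f' :=
  PresentedGroup.ext fun x => by
    rw [MonoidHom.mul_apply, SurfaceGroup.toCommGroup_of, SurfaceGroup.toCommGroup_of,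
      SurfaceGroup.toCommGroup_of, Pi.mul_apply]

/-- The character with value vector `u + v` is the product of the characters with value vectors `u`,
`v`. [cite: HatcherAT2002, §1.2 p. 51] -/
theorem SurfaceGroup.toCommGroup_ofAdd_add (u v : surfaceGen h → ZMod p) :
    SurfaceGroup.toCommGroup (fun x => ofAdd ((u + v) x)) =
      SurfaceGroup.toCommGroup (fun x => ofAdd (u x)) * SurfaceGroup.toCommGroup (fun x => ofAdd (v x)) := by
  rw [← SurfaceGroup.toCommGroup_mul]
  rfl

/-- The character with value vector `c • u` is the `c.val`-th power of the character with value vector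
`u`. [cite: HatcherAT2002, §1.2 p. 51] -/
theorem SurfaceGroup.toCommGroup_ofAdd_smul [NeZero p] (c : ZMod p) (u : surfaceGen h → ZMod p) :
    SurfaceGroup.toCommGroup (fun x => ofAdd ((c • u) x)) =
      (SurfaceGroup.toCommGroup (fun x => ofAdd (u x))) ^ c.val :=
  PresentedGroup.ext fun x => by
    rw [MonoidHom.pow_apply, SurfaceGroup.toCommGroup_of, SurfaceGroup.toCommGroup_of, Pi.smul_apply,
      smul_eq_mul, ← ofAdd_nsmul, nsmul_eq_mul, ZMod.natCast_zmod_val]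

/-- **The Heisenberg obstruction of the pair of characters with value vectors `u`, `v` is the
intersection form `ν(u, v)`** (both are `∑ᵢ (u(aᵢ) v(bᵢ) - u(bᵢ) v(aᵢ))`).
[cite: ZieschangVogtColdewey1980, 3.6.5] -/
theorem SurfaceGroup.obstruction_eq_symplZMod (u v : surfaceGen h → ZMod p) :
    (∑ i : Fin h,
      ((toAdd (((SurfaceGroup.toCommGroup fun x => ofAdd (u x)).prod
          (SurfaceGroup.toCommGroup fun x => ofAdd (v x))) (SurfaceGroup.a i)).1) *
        (toAdd (((SurfaceGroup.toCommGroup fun x => ofAdd (u x)).prod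
          (SurfaceGroup.toCommGroup fun x => ofAdd (v x))) (SurfaceGroup.b i)).2) -
       (toAdd (((SurfaceGroup.toCommGroup fun x => ofAdd (u x)).prod
          (SurfaceGroup.toCommGroup fun x => ofAdd (v x))) (SurfaceGroup.a i)).2) *
        (toAdd (((SurfaceGroup.toCommGroup fun x => ofAdd (u x)).prod
          (SurfaceGroup.toCommGroup fun x => ofAdd (v x))) (SurfaceGroup.b i)).1))) =
      ∑ i, (u (i, false) * v (i, true) - u (i, true) * v (i, false)) := by
  refine Finset.sum_congr rfl fun i _ => ?_
  simp only [MonoidHom.prod_apply, SurfaceGroup.toCommGroup_a, SurfaceGroup.toCommGroup_b, toAdd_ofAdd]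
  ring

end Characters

/-! ### The extraspecial group of order `p³` and the lifting of pairs of characters (order exposed) -/

/-- **The extraspecial lift, with the order of the group exposed.**  For a prime `p` there are a finite
group `E` of order `p³` and a homomorphism `α : E → 𝔽_p × 𝔽_p` such that (1) no lift of `(1, 0)`
commutes with a lift of `(0, 1)`, and (2) every `Φ : S_h → 𝔽_p × 𝔽_p` with vanishing Heisenberg
obstruction `ω(Φ) = ∑ᵢ (Φ₁(aᵢ) Φ₂(bᵢ) - Φ₂(aᵢ) Φ₁(bᵢ))` lifts through `α`.  Same construction as
abc-iut-L5-t17's `exists_extraspecial_lift` (`SurfaceGroupHeisenbergLift.lean`): the cocycle extension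
of `𝔽_p²` by the trivial module `𝔽_p` with bilinear cocycle `B(u, v) = u₁ v₂`; the order is read off
`CocycleExtension.equivProd`. [cite: Brown1982CohomologyGroups, IV §3 (3.3)–(3.5)] -/
theorem exists_extraspecial_lift_card (p : ℕ) [hp : Fact p.Prime] :
    ∃ (E : Type) (_ : Group E) (_ : Finite E)
      (α : E →* Multiplicative (ZMod p) × Multiplicative (ZMod p)),
      Nat.card E = p ^ 3 ∧
      (∀ x y : E, α x = (ofAdd 1, 1) → α y = (1, ofAdd 1) → x * y ≠ y * x) ∧
      ∀ (h : ℕ) (Φ : SurfaceGroup h →* Multiplicative (ZMod p) × Multiplicative (ZMod p)),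
        (∑ i : Fin h, ((toAdd (Φ (SurfaceGroup.a i)).1) * (toAdd (Φ (SurfaceGroup.b i)).2) -
            (toAdd (Φ (SurfaceGroup.a i)).2) * (toAdd (Φ (SurfaceGroup.b i)).1))) = 0 →
        ∃ θ : SurfaceGroup h →* E, ∀ s, α (θ s) = Φ s := by
  classical
  haveI : NeZero p := ⟨hp.out.ne_zero⟩
  -- the bilinear cocycle `B(u, v) = u₁ v₂` on `V = 𝔽_p × 𝔽_p`
  let B : (ZMod p × ZMod p) →+ (ZMod p × ZMod p) →+ ZMod p :=
    { toFun := fun u =>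
        { toFun := fun v => u.1 * v.2
          map_zero' := by simp
          map_add' := fun v v' => by simp only [Prod.snd_add, mul_add] }
      map_zero' := AddMonoidHom.ext fun v => by simp
      map_add' := fun u u' => AddMonoidHom.ext fun v => by
        simp only [AddMonoidHom.coe_mk, ZeroHom.coe_mk, AddMonoidHom.add_apply, Prod.fst_add, add_mul] }
  have hB : ∀ u v : ZMod p × ZMod p, B u v = u.1 * v.2 := fun u v => rfl
  obtain ⟨f, hf⟩ := exists_cocycles₂_of_biadditive B
  haveI hfinA : Finite (Rep.trivial (ZMod p) (Multiplicative (ZMod p × ZMod p)) (ZMod p)) :=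
    inferInstanceAs (Finite (ZMod p))
  -- `α : E_f → V → 𝔽_p × 𝔽_p` (coordinates)
  let cf : Multiplicative (ZMod p × ZMod p) →* Multiplicative (ZMod p) × Multiplicative (ZMod p) :=
    ((AddMonoidHom.fst (ZMod p) (ZMod p)).toMultiplicative).prod
      ((AddMonoidHom.snd (ZMod p) (ZMod p)).toMultiplicative)
  let α : CocycleExtension f →* Multiplicative (ZMod p) × Multiplicative (ZMod p) :=
    cf.comp (CocycleExtension.rightHom f)
  have hα : ∀ x : CocycleExtension f, α x = (ofAdd (toAdd x.right).1, ofAdd (toAdd x.right).2) :=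
    fun x => rfl
  -- commutators of lifts
  have hcomm : ∀ x y : CocycleExtension f, x * y * x⁻¹ * y⁻¹ =
      CocycleExtension.inl f (ofAdd ((toAdd x.right).1 * (toAdd y.right).2 -
        (toAdd y.right).1 * (toAdd x.right).2)) := fun x y => by
    rw [CocycleExtension.commutator_eq_inl_of_trivial f x y (Commute.all _ _), hf, hf, hB, hB]
  refine ⟨CocycleExtension f, inferInstance, inferInstance, α, ?_, ?_, ?_⟩
  · -- (0) the order `p · p² = p³`
    have hcardA : Nat.card (Rep.trivial (ZMod p) (Multiplicative (ZMod p × ZMod p)) (ZMod p)) = p :=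
      Nat.card_zmod p
    rw [Nat.card_congr (CocycleExtension.equivProd f), Nat.card_prod, hcardA]
    rw [show Nat.card (Multiplicative (ZMod p × ZMod p)) = Nat.card (ZMod p × ZMod p) from rfl,
      Nat.card_prod, Nat.card_zmod]
    ring
  · -- (1) no commuting lifts of the basis
    intro x y hx hy hxy
    rw [hα, Prod.mk.injEq] at hx hy
    have hx1 : (toAdd x.right).1 = 1 := by simpa using congrArg toAdd hx.1
    have hx2 : (toAdd x.right).2 = 0 := by simpa using congrArg toAdd hx.2
    have hy1 : (toAdd y.right).1 = 0 := by simpa using congrArg toAdd hy.1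
    have hy2 : (toAdd y.right).2 = 1 := by simpa using congrArg toAdd hy.2
    have hc := hcomm x y
    rw [hx1, hx2, hy1, hy2, mul_one, mul_zero, sub_zero, hxy, mul_inv_cancel_right,
      mul_inv_cancel] at hc
    have h1 : CocycleExtension.inl f (ofAdd (1 : ZMod p)) = CocycleExtension.inl f 1 := by
      rw [(CocycleExtension.inl f).map_one]; exact hc.symm
    have h2 := CocycleExtension.inl_injective f h1
    rw [ofAdd_eq_one] at h2
    exact one_ne_zero h2
  · -- (2) lifting when `ω(Φ) = 0`
    intro h Φ hω
    let F : surfaceGen h → CocycleExtension f := fun x =>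
      ⟨0, ofAdd (toAdd (Φ (PresentedGroup.of x)).1, toAdd (Φ (PresentedGroup.of x)).2)⟩
    have hFr : ∀ x, (F x).right =
        ofAdd (toAdd (Φ (PresentedGroup.of x)).1, toAdd (Φ (PresentedGroup.of x)).2) := fun x => rfl
    have hrel : ∀ r ∈ ({surfaceRelator h} : Set (FreeGroup (surfaceGen h))),
        FreeGroup.lift F r = 1 := by
      intro r hr
      rw [Set.mem_singleton_iff] at hr
      subst hr
      rw [surfaceRelator, map_list_prod, List.map_map]
      let c : Fin h → ZMod p := fun i =>
        (toAdd (Φ (PresentedGroup.of (i, false))).1) * (toAdd (Φ (PresentedGroup.of (i, true))).2) -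
          (toAdd (Φ (PresentedGroup.of (i, false))).2) * (toAdd (Φ (PresentedGroup.of (i, true))).1)
      have hterm : ∀ i : Fin h,
          (FreeGroup.lift F ∘ fun i => genA i * genB i * (genA i)⁻¹ * (genB i)⁻¹) i =
            CocycleExtension.inl f (ofAdd (c i)) := by
        intro i
        simp only [Function.comp_apply, map_mul, map_inv, genA, genB, FreeGroup.lift_apply_of]
        rw [hcomm, hFr, hFr, toAdd_ofAdd, toAdd_ofAdd]
        change _ = CocycleExtension.inl f (ofAdd
          ((toAdd (Φ (PresentedGroup.of (i, false))).1) * (toAdd (Φ (PresentedGroup.of (i, true))).2) -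
          (toAdd (Φ (PresentedGroup.of (i, false))).2) * (toAdd (Φ (PresentedGroup.of (i, true))).1)))
        rw [mul_comm (toAdd (Φ (PresentedGroup.of (i, true))).1)]
      have hlist : ∀ (L : List (Fin h)),
          (L.map fun i => CocycleExtension.inl f (ofAdd (c i))).prod =
            CocycleExtension.inl f (ofAdd (L.map c).sum) := by
        intro L
        induction L with
        | nil => rw [List.map_nil, List.prod_nil, List.map_nil, List.sum_nil, ofAdd_zero, map_one]
        | cons x L ih =>
          rw [List.map_cons, List.prod_cons, List.map_cons, List.sum_cons, ofAdd_add, map_mul, ih]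
      have hω' : ((List.finRange h).map c).sum = 0 := by
        rw [← Fin.sum_univ_def]
        simpa only [SurfaceGroup.a, SurfaceGroup.b] using hω
      rw [List.map_congr_left (fun i _ => hterm i), hlist, hω', ofAdd_zero, map_one]
    refine ⟨PresentedGroup.toGroup hrel, fun s => ?_⟩
    have hgen : ∀ x : surfaceGen h,
        α (PresentedGroup.toGroup hrel (PresentedGroup.of x)) = Φ (PresentedGroup.of x) := by
      intro x
      rw [PresentedGroup.toGroup.of, hα, hFr, toAdd_ofAdd]
      change (ofAdd (toAdd (Φ (PresentedGroup.of x)).1), ofAdd (toAdd (Φ (PresentedGroup.of x)).2)) = _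
      rw [ofAdd_toAdd, ofAdd_toAdd]
    exact DFunLike.congr_fun (PresentedGroup.ext (φ := α.comp (PresentedGroup.toGroup hrel))
      (ψ := Φ) hgen) s

end Literature.GroupTheory.CombinatorialGroupTheory

end
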